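import Summits.ValiantsHypothesis.ValiantsHypothesis.Theorems.KPlusLogSqLawTropicalBBasisExchange
import Summits.ValiantsHypothesis.ValiantsHypothesis.Theorems.KPlusLogSqLawTropicalBSplitGlue
import Summits.ValiantsHypothesis.ValiantsHypothesis.Theorems.KPlusLogSqLawTropicalExchange

/-!
# Route «KPlusLogSqLaw», crux `TropicalB` (stmt-ValiantsHypothesis-19771) — THE REGISTER-PAIR LAW, part 1:
# the parallelogram law and gadget minimality

HONEST FRAMING.  Helper toward the registered stubs `stub_tropThin` / `stub_tropFat` of `Cruxes/TropicalB/Lines/birth.lean` (crux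
`Summit.ValiantsHypothesis.ValiantsHypothesis.Theses.KPlusLogSqLaw.TropicalB`, item stmt-ValiantsHypothesis-19771, route KPlusLogSqLaw;
cell `pub-symmetroid`, seat val-sym-trop-p4 g11, 2026-08-27; `--supports … --as helper`).  STRUCTURE lemmas about unique optima
(`IsDominant`) of an ARBITRARY dominance design, consumed by part 2 (…TropicalBRegisterPair, the register-pair law); nothing here bounds
`TropicalB`, and nothing bears on `WeakLifting`, DoorA26 / DoorA34, `MatrixDescartes` (stmt-ValiantsHypothesis-18050) or VP ≠ VNP.

* `parallelogram` — PARALLELOGRAM LAW: if `B`, `C` are unique optima (at any integer slopes) and `A`, `D` are present terms with slopes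
  `S_A + S_D = S_B + S_C`, `S_A < S_B`, `S_A < S_C`, then the valuation sums satisfy `V_B + V_C < V_A + V_D` (the dominant terms are
  vertices of the lower hull of the points `(slope, valuation sum)`; an inner point of an arithmetic quadruple lies strictly below the chord).
* `isPMatching_gad`, `rng_gad`, `dom_gad`, `card_gad`, `wt_gad` — the GADGET PART `{(σ g, g) : g ∈ G}` of a term on a column set `G`, as a
  matching in the tree's `PBij` vocabulary (…TropicalBMatchingExchange), its row/column sets, size and weight.
* `gadget_min` — GADGET MINIMALITY: if `p` is the unique optimum at `θ` and uses one class `l₀` on the columns `G`, its gadget part is the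
  cheapest matching of `G` into the same rows through present class-`l₀` cells (re-matching the gadget gives a present competitor of the
  same slope).
* `erase_insert_insert` — a two-element `insert`/`erase` identity used by part 2.

[folklore: lower convex hulls; sub-optimality of optimal assignments]
-/

set_option linter.dupNamespace false
set_option autoImplicit false

namespace Summit.ValiantsHypothesis.ValiantsHypothesis.Theorems.KPlusLogSqLaw

namespace RegisterPair

open Summit.ValiantsHypothesis.ValiantsHypothesis.Theorems.MatrixDescartes.Negative
open Summit.ValiantsHypothesis.ValiantsHypothesis.Theorems.LacunarySymmetroidMatrixDescartes
open Summit.ValiantsHypothesis.ValiantsHypothesis.Theorems.LacunarySymmetroidMatrixDescartes.TropicalCensus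
open Summit.ValiantsHypothesis.ValiantsHypothesis.Theorems.KPlusLogSqLaw.MatchingExchange
open Literature.Computability.MetaComplexity.PBij
open scoped BigOperators
open Finset

variable {m K : ℕ}

/-! ### 1. The parallelogram law (convexity of the hull on an arithmetic quadruple of slopes) -/

/-- **PARALLELOGRAM LAW.**  If `B` and `C` are unique optima (at any integer slopes), `A` and `D` are present, the slopes satisfy
`S_A + S_D = S_B + S_C` with `S_A < S_B` and `S_A < S_C`, then the valuation sums satisfy `V_B + V_C < V_A + V_D`.
[folklore: vertices of a lower convex hull] -/
theorem parallelogram (d : Fin K → ℕ) (v ε : Fin m → Fin m → Fin K → ℤ) {θB θC : ℤ}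
    {A B C D : Equiv.Perm (Fin m) × (Fin m → Fin K)}
    (hB : IsDominant d v ε θB B) (hC : IsDominant d v ε θC C) (hA : termSign ε A ≠ 0) (hD : termSign ε D ≠ 0)
    (hS : slope d A + slope d D = slope d B + slope d C) (hAB : slope d A < slope d B) (hAC : slope d A < slope d C) :
    (∑ i, v (B.1 i) i (B.2 i)) + ∑ i, v (C.1 i) i (C.2 i) < (∑ i, v (A.1 i) i (A.2 i)) + ∑ i, v (D.1 i) i (D.2 i) := by
  have hBD : slope d B < slope d D := by linarith
  have hCD : slope d C < slope d D := by linarith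
  have hAneB : A ≠ B := fun h => by rw [h] at hAB; exact lt_irrefl _ hAB
  have hAneC : A ≠ C := fun h => by rw [h] at hAC; exact lt_irrefl _ hAC
  have hDneB : D ≠ B := fun h => by rw [h] at hBD; exact lt_irrefl _ hBD
  have hDneC : D ≠ C := fun h => by rw [h] at hCD; exact lt_irrefl _ hCD
  have h1 := hB.2 A hAneB hA
  have h2 := hB.2 D hDneB hD
  have h3 := hC.2 A hAneC hA
  have h4 := hC.2 D hDneC hD
  rw [tropWeight_eq_slope_sub, tropWeight_eq_slope_sub] at h1 h2 h3 h4
  set sA := slope d A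
  set sB := slope d B
  set sC := slope d C
  set sD := slope d D
  set VA := ∑ i, v (A.1 i) i (A.2 i)
  set VB := ∑ i, v (B.1 i) i (B.2 i)
  set VC := ∑ i, v (C.1 i) i (C.2 i)
  set VD := ∑ i, v (D.1 i) i (D.2 i)
  have p1 := mul_lt_mul_of_pos_left h1 (show (0 : ℤ) < sD - sB by linarith)
  have p2 := mul_lt_mul_of_pos_left h2 (show (0 : ℤ) < sB - sA by linarith)
  have p3 := mul_lt_mul_of_pos_left h3 (show (0 : ℤ) < sD - sC by linarith)
  have p4 := mul_lt_mul_of_pos_left h4 (show (0 : ℤ) < sC - sA by linarith)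
  have k1 : (sD - sA) * VB < (sD - sB) * VA + (sB - sA) * VD := by nlinarith [p1, p2]
  have k2 : (sD - sA) * VC < (sD - sC) * VA + (sC - sA) * VD := by nlinarith [p3, p4]
  have hD' : sD = sB + sC - sA := by linarith
  have k3 : (sD - sA) * (VB + VC) < (sD - sA) * (VA + VD) := by
    have e1 : (sD - sB) * VA + (sD - sC) * VA = (sD - sA) * VA := by rw [hD']; ring
    have e2 : (sB - sA) * VD + (sC - sA) * VD = (sD - sA) * VD := by rw [hD']; ring
    nlinarith [k1, k2, e1, e2]
  exact lt_of_mul_lt_mul_left k3 (by linarith)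

/-! ### 2. The gadget part of a term as a matching, and its minimality under dominance -/

/-- the gadget part `{(σ g, g) : g ∈ G}` of a term is a matching. [folklore] -/
theorem isPMatching_gad (σ : Equiv.Perm (Fin m)) (G : Finset (Fin m)) :
    IsPMatching (G.image fun g => (σ g, g)) := by
  intro p hp q hq hpq
  obtain ⟨g, -, rfl⟩ := Finset.mem_image.1 hp
  obtain ⟨g', -, rfl⟩ := Finset.mem_image.1 hq
  rcases hpq with h | h
  · have : g = g' := σ.injective h
    subst this; rfl
  · simp only at h; subst h; rfl

/-- its column set is `G`. [folklore] -/
theorem rng_gad (σ : Equiv.Perm (Fin m)) (G : Finset (Fin m)) : rng (G.image fun g => (σ g, g)) = G := by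
  ext c
  simp only [mem_rng, Finset.mem_image]
  constructor
  · rintro ⟨a, g, hg, h⟩
    have := (Prod.mk.inj h).2; subst this; exact hg
  · intro hc; exact ⟨σ c, c, hc, rfl⟩

/-- its row set is `σ(G)`. [folklore] -/
theorem dom_gad (σ : Equiv.Perm (Fin m)) (G : Finset (Fin m)) : dom (G.image fun g => (σ g, g)) = G.image σ := by
  ext a
  simp only [mem_dom, Finset.mem_image]
  constructor
  · rintro ⟨c, g, hg, h⟩
    exact ⟨g, hg, (Prod.mk.inj h).1⟩
  · rintro ⟨g, hg, rfl⟩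
    exact ⟨g, g, hg, rfl⟩

/-- it has `|G|` edges. [folklore] -/
theorem card_gad (σ : Equiv.Perm (Fin m)) (G : Finset (Fin m)) : (G.image fun g => (σ g, g)).card = G.card :=
  Finset.card_image_of_injective _ fun _ _ h => (Prod.mk.inj h).2

/-- its weight is the gadget value of the term. [folklore] -/
theorem wt_gad (σ : Equiv.Perm (Fin m)) (G : Finset (Fin m)) (w : Fin m → Fin m → ℤ) :
    ∑ e ∈ G.image (fun g => (σ g, g)), w e.1 e.2 = ∑ g ∈ G, w (σ g) g := by
  rw [Finset.sum_image fun _ _ _ _ h => (Prod.mk.inj h).2]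

/-- **GADGET MINIMALITY.**  If `p` is the unique optimum at `θ` and uses one class `l₀` on the gadget columns `G`, then among ALL matchings
of `G` into the same rows through present class-`l₀` cells, the gadget part of `p` has the least valuation sum (the competitor obtained by
re-matching the gadget is a present term of the same slope). [folklore] -/
theorem gadget_min (d : Fin K → ℕ) (v ε : Fin m → Fin m → Fin K → ℤ) {θ : ℤ}
    {p : Equiv.Perm (Fin m) × (Fin m → Fin K)} (hp : IsDominant d v ε θ p) (G : Finset (Fin m)) (l₀ : Fin K)
    (hcls : ∀ g ∈ G, p.2 g = l₀) {Y : Finset (Fin m × Fin m)} (hY : IsPMatching Y) (hrng : rng Y = G)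
    (hdom : dom Y = G.image p.1) (hpres : ∀ e ∈ Y, ε e.1 e.2 l₀ ≠ 0) :
    ∑ g ∈ G, v (p.1 g) g l₀ ≤ ∑ e ∈ Y, v e.1 e.2 l₀ := by
  classical
  -- the row of `Y` at a gadget column
  have huniq : ∀ c, c ∈ G → ∃! e, e ∈ Y ∧ e.2 = c := by
    intro c hc
    obtain ⟨a, ha⟩ := mem_rng.1 (hrng.symm ▸ hc)
    exact ⟨(a, c), ⟨ha, rfl⟩, fun e he => hY e he.1 (a, c) ha (Or.inr he.2)⟩
  let σ' : Fin m → Fin m := fun c => if hc : c ∈ G then (Y.choose (fun e => e.2 = c) (huniq c hc)).1 else p.1 c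
  have hσ'G : ∀ c, c ∈ G → (σ' c, c) ∈ Y := by
    intro c hc
    have hspec := Finset.choose_spec (fun e => e.2 = c) Y (huniq c hc)
    have h1 : σ' c = (Y.choose (fun e => e.2 = c) (huniq c hc)).1 := by simp only [σ', dif_pos hc]
    rw [h1]
    have h2 : ((Y.choose (fun e => e.2 = c) (huniq c hc)).1, c) = Y.choose (fun e => e.2 = c) (huniq c hc) :=
      Prod.ext rfl hspec.2.symm
    rw [h2]; exact hspec.1
  have hσ'nG : ∀ c, c ∉ G → σ' c = p.1 c := fun c hc => by simp only [σ', dif_neg hc]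
  have hσ'dom : ∀ c, c ∈ G → σ' c ∈ G.image p.1 := fun c hc => hdom ▸ mem_dom.2 ⟨c, hσ'G c hc⟩
  -- `σ'` is a permutation
  have hinj : Function.Injective σ' := by
    intro c c' h
    by_cases hc : c ∈ G <;> by_cases hc' : c' ∈ G
    · have e1 := hσ'G c hc
      have e2 := hσ'G c' hc'
      rw [h] at e1
      exact (Prod.mk.inj (hY _ e1 _ e2 (Or.inl rfl))).2
    · exfalso
      obtain ⟨g, hg, hgc⟩ := Finset.mem_image.1 (hσ'dom c hc)
      rw [h, hσ'nG c' hc'] at hgc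
      exact hc' (p.1.injective hgc ▸ hg)
    · exfalso
      obtain ⟨g, hg, hgc⟩ := Finset.mem_image.1 (hσ'dom c' hc')
      rw [← h, hσ'nG c hc] at hgc
      exact hc (p.1.injective hgc ▸ hg)
    · rw [hσ'nG c hc, hσ'nG c' hc'] at h
      exact p.1.injective h
  let π : Equiv.Perm (Fin m) := Equiv.ofBijective σ' (Finite.injective_iff_bijective.1 hinj)
  have hπ : ∀ c, π c = σ' c := fun c => rfl
  -- `Y` is the gadget part of the new term
  have hYeq : Y = G.image fun g => (σ' g, g) := by
    ext e
    constructor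
    · intro he
      have hc : e.2 ∈ G := hrng ▸ mem_rng.2 ⟨e.1, he⟩
      have h1 := hσ'G e.2 hc
      have : e = (σ' e.2, e.2) := hY _ he _ h1 (Or.inr rfl)
      exact Finset.mem_image.2 ⟨e.2, hc, this.symm⟩
    · intro he
      obtain ⟨g, hg, rfl⟩ := Finset.mem_image.1 he
      exact hσ'G g hg
  have hwY : ∑ e ∈ Y, v e.1 e.2 l₀ = ∑ g ∈ G, v (σ' g) g l₀ := by
    rw [hYeq]; exact wt_gad π G (fun a c => v a c l₀)
  -- the new term is present and has the same slope
  set p' : Equiv.Perm (Fin m) × (Fin m → Fin K) := (π, p.2) with hp'def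
  have hpres' : termSign ε p' ≠ 0 := by
    rw [termSign_ne_zero_iff]
    intro c
    by_cases hc : c ∈ G
    · show ε (σ' c) c (p.2 c) ≠ 0
      rw [hcls c hc]; exact hpres _ (hσ'G c hc)
    · show ε (σ' c) c (p.2 c) ≠ 0
      rw [hσ'nG c hc]; exact (termSign_ne_zero_iff ε p).1 hp.1 c
  -- split the valuation sums along `G`
  have hsplit : ∀ f : Fin m → ℤ, ∑ i, f i = (∑ i ∈ G, f i) + ∑ i ∈ Gᶜ, f i :=
    fun f => (Finset.sum_add_sum_compl G f).symm
  have hVp : ∑ i, v (p.1 i) i (p.2 i) = (∑ g ∈ G, v (p.1 g) g l₀) + ∑ i ∈ Gᶜ, v (p.1 i) i (p.2 i) := by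
    rw [hsplit]
    congr 1
    exact Finset.sum_congr rfl fun g hg => by rw [hcls g hg]
  have hVp' : ∑ i, v (p'.1 i) i (p'.2 i) = (∑ e ∈ Y, v e.1 e.2 l₀) + ∑ i ∈ Gᶜ, v (p.1 i) i (p.2 i) := by
    rw [hsplit, hwY]
    congr 1
    · exact Finset.sum_congr rfl fun g hg => by rw [hcls g hg]; rfl
    · exact Finset.sum_congr rfl fun i hi => by
        rw [Finset.mem_compl] at hi
        show v (σ' i) i (p.2 i) = _
        rw [hσ'nG i hi]
  by_cases hpp : p' = p
  · -- the re-matched gadget is the old one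
    have : ∑ i, v (p'.1 i) i (p'.2 i) = ∑ i, v (p.1 i) i (p.2 i) := by rw [hpp]
    rw [hVp, hVp'] at this
    linarith
  · have hlt := hp.2 p' hpp hpres'
    rw [tropWeight_eq_slope_sub, tropWeight_eq_slope_sub] at hlt
    have hslope : slope d p' = slope d p := rfl
    rw [hslope, hVp, hVp'] at hlt
    linarith

/-! ### 3. A small `insert`/`erase` identity -/

/-- two inserted elements: erase the inner one. [folklore] -/
theorem erase_insert_insert {x y : Fin m} {S : Finset (Fin m)} (hxy : x ≠ y) (hy : y ∉ S) :
    (insert x (insert y S)).erase y = insert x S := by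
  rw [Finset.insert_comm, Finset.erase_insert]
  exact fun h => by rcases Finset.mem_insert.1 h with h | h <;> [exact hxy h.symm; exact hy h]

end RegisterPair

end Summit.ValiantsHypothesis.ValiantsHypothesis.Theorems.KPlusLogSqLaw
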